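import Summits.Ventures.GridStability.Bench.GFMSMIBDeg4AQoriaV4physData
import Summits.Ventures.GridStability.Lyapunov.PolyRecastBox
import Mathlib.Tactic.Linarith
import Mathlib.Tactic.Positivity
import HarnessLib

/-!
# G3.a+ «GFM-SMIB-QoriaV4» deg-4 — REGION-SIZE rider «GFM-SMIB-DEG4 BALL» (recast half): the ellipsoid
# `σ² + κ² + ω²/100 ≤ (989/1000)²` on `{h = 0}` lies in the certified sublevel piece `{V₄ ≤ 21/4}`

Venture GRIDFUSION, cell `gridfusion`; seat gridfusion-lyap-2 (g4), LOW rider (pattern of «#50′ BALL» p537844 / «#62′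
WSCC9-DEG4-BALL» p543377): a kernel INNER description of the certified set of the deg-4 toolchain-A certificate of rung G3.a+
«GFM-SMIB-QoriaV4» (`Bench/GFMSMIBDeg4AQoriaV4phys{Data,}.lean`, sos-5 p470051 / p470060, A file
`cert/A/GFM-SMIB-deg4-A-QoriaV4phys.json` sha256 `be1bb781f69ae869…`; -roa companion `Bench/GFMSMIBDeg4AQoriaV4physRoa.lean`,
lyap-1), so that the converter-against-infinite-bus ROA sentence names a concrete neighbourhood of the synchronous equilibrium.
Inputs: the degree-4 literal `…_V_poly` (32 monomials) and the recast constraint(s) `…_h` of the Data file; the generic box majorant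
`Lyapunov/PolyRecastBox.lean` (p536818). NOTHING of the certificate is restated; generator `gen_ball.py gfmsmib4`
(HOME/lean/lyap-2/g4/; `s` found by exact search on the 1/1000 grid, V_poly parsed from the TREE file).

WHAT IS PROVED (kernel). With `s = 989/1000`: on `{h = 0}` (`h_j = κ_j² + σ_j² − 2κ_j`) the ellipsoid `sigma² + kappa² + omega²/100
≤ s²` forces `|σ| ≤ s`, `0 ≤ κ ≤ s²/2`, `|ω| ≤ 10·s`, and the coefficient majorant of the quartic `V` on that box is `absBox B
V_poly = 83845458371670540764887423038651/16000000000000000000000000000000 ≈ 5.240341 ≤ 21/4` (ONE `decide`); hence `V ≤ 21/4 = c` —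
THE ELLIPSOID LIES IN THE CERTIFIED PIECE (`…_V_le_level_of_ball`). `s` is the largest multiple of `1/1000` passing the test (at `s
+ 1/1000` the majorant is ≈ 5.258571 > c). The ω²-coefficient `1/100` of the ellipsoid is NOT the certificate gauge's `1/4500` (`φ =
σ² + κ² + ω²/4500`, ω in rad/s): with the gauge shape the crude majorant is frequency-limited (`|ω| ≤ √4500·s` makes the quartic
ω-terms dominate; best `s = 34/125`, 15.6°); the aspect ratio of an INNER ellipsoid is a free choice and `1/100` makes the test
angle-limited (same unclamped box test, exact scan in the generator, ω²-coefficient → angle reach / |Ω| reach: 1 → 66.9°/1.17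
rad·s⁻¹ (s = 1167/1000), 1/100 → 56.7°/9.89 rad·s⁻¹ (s = 989/1000), 1/4500 → 15.6°/18.2 rad·s⁻¹ (s = 34/125)). In the model's
coordinates (`σ² + κ² = 2 − 2cos u ≤ u²`): every state of the MODEL with `(δ − δ^s)² + Ω²/100 ≤ (989/1000)²` (`Ω` = frequency
deviation in rad/s: angle displaced by ≤ 0.989 rad = 56.7° at nominal frequency, or a frequency deviation ≤ 9.89 rad/s = 3.15 % of
`ω_b′ = 35500/113` at the operating angle) starts inside the certified region (model half: sibling `…RoaBallModel.lean`); the degree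
/ rad·s⁻¹ / percent renderings of `s` are VALIDATED-column readings of the exact literal, nothing more.

THREE COLUMNS. CERTIFIED (kernel): the inclusion «ellipsoid of gauge radius `989/1000` ∩ {h = 0} ⊆ {V ≤ 21/4}» for the certificate's
`V` — a crude (coefficient-majorant) but exact inner estimate; the true inner radius is larger; an inner set of a CERTIFICATE's
sublevel piece, never «the ROA of the system». MODELLED: as the parent row (M′ = reduced-order droop / VSM grid-forming converter
against an infinite bus ≡ classical SMIB in physical time, model-3 `InverterBridgesSMIB` p462458, model-1 `SMIB.gfmQoriaV4Phys`;
MODEL-VALIDITY MV-6D+MV-P+MV-Ω(ω_b′ = 35500/113): inner loops, filter / line / dc-side dynamics, current limits, voltage dynamics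
ABSENT). VALIDATED: only the renderings of `s`. No sentence here says a converter or a grid is stable.
-/

namespace Summit.Ventures.GridStability.Bench.GFMSMIB

open Literature.Computation.Certificates Literature.Computation.Certificates.SOS
open Literature.Computation.Certificates.SOS.Poly
open Summit.Ventures.GridStability.Lyapunov

noncomputable section

/-- The box of the rider: `|σ| ≤ s`, `|κ| ≤ s²/2`, `|ω| ≤ 10·s` with `s = 989/1000`, in the certificate's variable order
`(sigma, kappa, omega)`. [folklore] -/
def deg4_A_QoriaV4phys_boxB : List ℚ := [989/1000, 978121/2000000, 989/100]

set_option maxRecDepth 100000 in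
/-- **The coefficient majorant of the quartic `V` on the box is below the level**: `absBox B V_poly ≤ 21/4`
(ONE `decide` over the 32 monomials; exact value `83845458371670540764887423038651/16000000000000000000000000000000`). [folklore] -/
theorem deg4_A_QoriaV4phys_absBox_le :
    PolyRecast.absBox (vars deg4_A_QoriaV4phys_boxB) deg4_A_QoriaV4phys_V_poly ≤ 21 / 4 := by
  decide +kernel

/-- **«BALL» (recast coordinates): the ellipsoid lies in the certified piece.** For every point of `{h = 0}` with
`sigma² + kappa² + omega²/100 ≤ (989/1000)²`: `V ≤ 21/4`. [folklore] -/
theorem deg4_A_QoriaV4phys_V_le_level_of_ball (sigma kappa omega : ℝ)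
    (hh : deg4_A_QoriaV4phys_h sigma kappa omega = 0)
    (hball : sigma ^ 2 + kappa ^ 2 + omega ^ 2 / 100 ≤ (989 / 1000 : ℝ) ^ 2) :
    deg4_A_QoriaV4phys_V sigma kappa omega ≤ 21 / 4 := by
  simp only [deg4_A_QoriaV4phys_h, deg4_A_QoriaV4phys_h_poly, eval_cons, eval_nil, Monomial.eval_eq, Monomial.evalFrom_cons, Monomial.evalFrom_nil,
    vars_cons_zero, vars_cons_succ] at hh
  push_cast at hh
  norm_num at hh
  have hb0 : |sigma| ≤ (989 / 1000 : ℝ) := abs_le.2 (abs_le_of_sq_le_sq' (by nlinarith [sq_nonneg sigma, sq_nonneg kappa, sq_nonneg omega]) (by norm_num))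
  have hb1 : |kappa| ≤ (978121 / 2000000 : ℝ) := abs_le.2 ⟨by nlinarith [hh, sq_nonneg sigma, sq_nonneg kappa, sq_nonneg omega], by nlinarith [hh, hball, sq_nonneg sigma, sq_nonneg kappa, sq_nonneg omega]⟩
  have hb2 : |omega| ≤ (989 / 100 : ℝ) := abs_le.2 (abs_le_of_sq_le_sq' (by nlinarith [sq_nonneg sigma, sq_nonneg kappa, sq_nonneg omega]) (by norm_num))
  have hB : ∀ i, |vars [sigma, kappa, omega] i| ≤ ((vars deg4_A_QoriaV4phys_boxB i : ℚ) : ℝ) := by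
    intro i
    match i with
    | 0 => simpa [deg4_A_QoriaV4phys_boxB] using hb0
    | 1 => simpa [deg4_A_QoriaV4phys_boxB] using hb1
    | 2 => simpa [deg4_A_QoriaV4phys_boxB] using hb2
    | n + 3 => simp [deg4_A_QoriaV4phys_boxB, vars]
  have h := PolyRecast.eval_le_absBox hB deg4_A_QoriaV4phys_V_poly
  have hc : ((PolyRecast.absBox (vars deg4_A_QoriaV4phys_boxB) deg4_A_QoriaV4phys_V_poly : ℚ) : ℝ) ≤ ((21 / 4 : ℚ) : ℝ) :=
    Rat.cast_le.2 deg4_A_QoriaV4phys_absBox_le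
  have hc' : ((21 / 4 : ℚ) : ℝ) = 21 / 4 := by norm_num
  exact h.trans (hc.trans_eq hc')

end

end Summit.Ventures.GridStability.Bench.GFMSMIB
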